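import Mathlib
import HarnessLib
import Summits.HubbardSuperconductivity.HubbardSuperconductivity.Theorems.KLProgrammeKLRegimeWickEffectiveActionLegDressing
import Summits.HubbardSuperconductivity.HubbardSuperconductivity.Theorems.KLProgrammeKLRegimeWickCrossContractionSum
import Summits.HubbardSuperconductivity.HubbardSuperconductivity.Theorems.KLProgrammeKLRegimeSplitLegDressingHist

/-!
# Route `KLProgramme` — gen-6 ENGINE child on `klPredsV16` (successor of stmt-HubbardSuperconductivity-19918), `stub_engine_step_values`, (E2-v10)
# leg-dress line, END TO END ON THE PLAIN CARRIERS: the one-line (leg-dressing) term of step `n−1 → n`,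
# `𝒱₄(dblFold(Δ_×(g_n)(𝒱_{n−1}⁰·𝒱_{n−1}¹)))` at any `±ω₀` four-leg configuration, is within `legDressBarQ2 G P Q U n (legSliceCountT … n k)`
# (cell gate-hubbard-kl, seat hubbard-kl-k3c2-p3 g3, row «leg-dress bar»; assembles `vertexFn_dblFold_oneLine_effectiveAction` (exact identity),
# `contr_klSliceCov_eq_diagContr` (the slice line is diagonal), `…SplitLegDressingRev` (per-leg sizes at `±ω₀`) and `…SplitLegDressingHist` (V16 door))

Objects: `𝒱_{n−1} = klEffectiveAction … klE0 (n−1)`, slice line `g_n = klSliceCov … n = C^K_{>Λ_n} − C^K_{>Λ_{n−1}}` with values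
`ℓ_n(p) = (w_{Λ_n}(p) − w_{Λ_{n−1}}(p))·βL²·ĝ_K(p)` (`klSliceLineVal`), self-energy `Σ_{n−1} = klSelfEnergy … klE0 (n−1)`.
* §1 per leg: `‖ℓ_n(p)‖ ≤ (‖g_n(ψ̂⁺_p,ψ̂⁻_p)‖ + ‖g_n(ψ̂⁻_p,ψ̂⁺_p)‖)/2` (`norm_contr_le`), hence under the history slots
  `‖ℓ_n(ω,k⃗)‖·‖Σ_{n−1}(ω,k⃗,σ)‖ ≤ βL²·bracket` for `ω ∈ {ω₀,−ω₀}` (`klld_lineVal_mul_selfEnergy_le`), and `ℓ_n(ω,k⃗) = 0` off the counted window;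
* §2 **`norm_vertexFn_oneLine_plain_le`**: `‖𝒱₄(dblFold(Δ_×(g_n)(𝒱_{n−1}⁰𝒱_{n−1}¹)))(Z)‖ ≤ 2·‖𝒱₄(𝒱_{n−1})(Z)‖·bracket·legSliceCountT … n k`;
  **`norm_vertexFn_oneLine_plain_le_legDressBarQ2`** (value `≤ v ≤ Klam|U|`, threshold `128cr+64cz ≤ Q.CR·Klam`) and the V16-history door
  **`norm_vertexFn_oneLine_plain_le_legDressBarQ2_of_histP_V16`** (`Q := klEngQ5 P R`, binders of `stub_engine_step_values`): `… ≤ legDressBarQ2 …`.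
Proved; no definitions (`klSliceLineVal` is an abbreviation-free local notation spelled out); slot texts untouched.
-/

noncomputable section

namespace Summit.HubbardSuperconductivity.HubbardSuperconductivity.Theorems.KLRegimeSplit

set_option linter.dupNamespace false -- summit = problem name (single-conjunct summit), D-0017

open Real Finset Literature.MathematicalPhysics.QuantumLattice Literature.Probability.LatticeModels GrassmannAlgebra
open Summit.HubbardSuperconductivity.HubbardSuperconductivity.Theorems.KLProgrammeLegKernels
open Summit.HubbardSuperconductivity.HubbardSuperconductivity.Theorems.TwoPointAssembly
open Summit.HubbardSuperconductivity.HubbardSuperconductivity.Theorems.KLRegimeWick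
open Summit.HubbardSuperconductivity.HubbardSuperconductivity.Theorems.EngineV8

section Model

variable {L M : ℕ} [NeZero L] [NeZero M]

/-! ## §1 The slice line value against the self-energy, per leg -/

omit [NeZero M] in
/-- **The slice line value is half the antisymmetrised entry**, so `‖ℓ_n(p)‖ ≤ (‖g_n(ψ̂⁺_{pσ},ψ̂⁻_{pσ})‖ + ‖g_n(ψ̂⁻_{pσ},ψ̂⁺_{pσ})‖)/2`. -/
theorem norm_sliceLineVal_le {β : ℝ} (hβ : β ≠ 0) (μ : ℝ) (K : TrigPolyC4v) (n : ℕ) (p : FreqMomentum L M) (σ : Fin 2) :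
    ‖((hubbardCutoffWeightCT L M β μ K (klScale klE0 n) p - hubbardCutoffWeightCT L M β μ K (klScale klE0 (n - 1)) p : ℝ) : ℂ) *
        (((β * (L : ℝ) ^ 2 : ℝ) : ℂ) * propCT L M β μ K p)‖ ≤
      (‖hubbardCovSliceCT L M β μ 0 K (klScale klE0 n) (klScale klE0 (n - 1)) ((p, σ), 0) ((p, σ), 1)‖ +
        ‖hubbardCovSliceCT L M β μ 0 K (klScale klE0 n) (klScale klE0 (n - 1)) ((p, σ), 1) ((p, σ), 0)‖) / 2 := by
  rw [← contr_klSliceCov_minus_plus hβ μ K n p σ]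
  exact norm_contr_le _ _ _

omit [NeZero L] in
/-- **Off the counted window the line value vanishes** (at either reading frequency). -/
theorem sliceLineVal_eq_zero_of_weight_eq (β μ : ℝ) (K : TrigPolyC4v) (n : ℕ) {ω : MatsubaraIdx M}
    (hω : ω = omega0 M ∨ ω = (omega0 M).rev) (k : TorusSite 2 L)
    (hw : hubbardCutoffWeightCT L M β μ K (klScale klE0 n) (omega0 M, k) = hubbardCutoffWeightCT L M β μ K (klScale klE0 (n - 1)) (omega0 M, k)) :
    ((hubbardCutoffWeightCT L M β μ K (klScale klE0 n) (ω, k) - hubbardCutoffWeightCT L M β μ K (klScale klE0 (n - 1)) (ω, k) : ℝ) : ℂ) *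
        (((β * (L : ℝ) ^ 2 : ℝ) : ℂ) * propCT L M β μ K (ω, k)) = 0 := by
  have hw' : hubbardCutoffWeightCT L M β μ K (klScale klE0 n) (ω, k) = hubbardCutoffWeightCT L M β μ K (klScale klE0 (n - 1)) (ω, k) := by
    rcases hω with rfl | rfl
    · exact hw
    · rwa [klld_weight_rev_eq, klld_weight_rev_eq]
  rw [hw', sub_self, Complex.ofReal_zero, zero_mul]

/-- **Per leg, under the history slots**: for `ω ∈ {ω₀, −ω₀}`, `‖ℓ_n(ω,k⃗)‖·‖Σ_{n−1}(ω,k⃗,σ)‖ ≤ βL²·(64cr|U|4⁻ⁿ + 16cz|U| + 4cz|U|(π/β)/Λ_n)`. -/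
theorem klld_lineVal_mul_selfEnergy_le {β U μ : ℝ} (hβ : 0 < β) {K : TrigPolyC4v} {R : RenConsts} (hcr : 0 ≤ R.cr) (hcz : 0 ≤ R.cz)
    {n : ℕ} (hn : 1 ≤ n) (hE0 : SelfEnergySymmetric L M β U μ K (n - 1)) (hren : RenormalisedAtF L M β U μ K R (n - 1))
    (hsl : TwoLegSlopes L M R β U μ K (n - 1)) {ω : MatsubaraIdx M} (hω : ω = omega0 M ∨ ω = (omega0 M).rev)
    (k : TorusSite 2 L) (σ : Fin 2) :
    ‖((hubbardCutoffWeightCT L M β μ K (klScale klE0 n) (ω, k) - hubbardCutoffWeightCT L M β μ K (klScale klE0 (n - 1)) (ω, k) : ℝ) : ℂ) *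
        (((β * (L : ℝ) ^ 2 : ℝ) : ℂ) * propCT L M β μ K (ω, k))‖ * ‖klSelfEnergy L M β U μ K klE0 (n - 1) (ω, k) σ‖ ≤
      β * (L : ℝ) ^ 2 *
        (64 * R.cr * |U| * ((4 : ℝ) ^ n)⁻¹ + 16 * R.cz * |U| + 4 * R.cz * |U| * ((Real.pi / β) / klScale klE0 n)) := by
  have h01 := klld_leg_dressing_tagged_le (L := L) (M := M) hβ hcr hcz hn hE0 hren hsl hω k σ 0 1
  have h10 := klld_leg_dressing_tagged_le (L := L) (M := M) hβ hcr hcz hn hE0 hren hsl hω k σ 1 0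
  have hS := norm_nonneg (klSelfEnergy L M β U μ K klE0 (n - 1) (ω, k) σ)
  have hℓ := norm_sliceLineVal_le (L := L) hβ.ne' μ K n (ω, k) σ
  calc _ ≤ (‖hubbardCovSliceCT L M β μ 0 K (klScale klE0 n) (klScale klE0 (n - 1)) (((ω, k), σ), 0) (((ω, k), σ), 1)‖ +
          ‖hubbardCovSliceCT L M β μ 0 K (klScale klE0 n) (klScale klE0 (n - 1)) (((ω, k), σ), 1) (((ω, k), σ), 0)‖) / 2 *
          ‖klSelfEnergy L M β U μ K klE0 (n - 1) (ω, k) σ‖ := mul_le_mul_of_nonneg_right hℓ hS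
    _ ≤ _ := by nlinarith

/-- **The four legs of a `±ω₀` configuration, summed with the count**:
`Σ_i ‖ℓ_n(ω_i,k_i)‖·‖Σ_{n−1}(ω_i,k_i,σ_i)‖ ≤ βL²·bracket·legSliceCountT … n k`. -/
theorem klld_sum_lineVal_mul_selfEnergy_le {β U μ : ℝ} (hβ : 0 < β) {K : TrigPolyC4v} {R : RenConsts} (hcr : 0 ≤ R.cr) (hcz : 0 ≤ R.cz)
    {n : ℕ} (hn : 1 ≤ n) (hE0 : SelfEnergySymmetric L M β U μ K (n - 1)) (hren : RenormalisedAtF L M β U μ K R (n - 1))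
    (hsl : TwoLegSlopes L M R β U μ K (n - 1)) {ω : Fin 4 → MatsubaraIdx M} (hω : ∀ i, ω i = omega0 M ∨ ω i = (omega0 M).rev)
    (k : Fin 4 → TorusSite 2 L) (σ : Fin 4 → Fin 2) :
    ∑ i : Fin 4, ‖((hubbardCutoffWeightCT L M β μ K (klScale klE0 n) (ω i, k i) -
          hubbardCutoffWeightCT L M β μ K (klScale klE0 (n - 1)) (ω i, k i) : ℝ) : ℂ) *
        (((β * (L : ℝ) ^ 2 : ℝ) : ℂ) * propCT L M β μ K (ω i, k i))‖ * ‖klSelfEnergy L M β U μ K klE0 (n - 1) (ω i, k i) (σ i)‖ ≤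
      β * (L : ℝ) ^ 2 *
          (64 * R.cr * |U| * ((4 : ℝ) ^ n)⁻¹ + 16 * R.cz * |U| + 4 * R.cz * |U| * ((Real.pi / β) / klScale klE0 n)) *
        (legSliceCountT L β μ K n k : ℝ) := by
  have hΛ := klth_klScale_pos n
  have hπβ : 0 ≤ Real.pi / β := (div_pos Real.pi_pos hβ).le
  have hz0 : 0 ≤ β * (L : ℝ) ^ 2 *
      (64 * R.cr * |U| * ((4 : ℝ) ^ n)⁻¹ + 16 * R.cz * |U| + 4 * R.cz * |U| * ((Real.pi / β) / klScale klE0 n)) := by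
    positivity
  have hb := fun i => klld_lineVal_mul_selfEnergy_le (L := L) (M := M) hβ hcr hcz hn hE0 hren hsl (hω i) (k i) (σ i)
  have h0 : ∀ i : Fin 4, ¬ (hubbardCutoffWeightCT L M β μ K (klScale klE0 n) (omega0 M, k i) ≠
        hubbardCutoffWeightCT L M β μ K (klScale klE0 (n - 1)) (omega0 M, k i)) →
      ‖((hubbardCutoffWeightCT L M β μ K (klScale klE0 n) (ω i, k i) -
          hubbardCutoffWeightCT L M β μ K (klScale klE0 (n - 1)) (ω i, k i) : ℝ) : ℂ) *
        (((β * (L : ℝ) ^ 2 : ℝ) : ℂ) * propCT L M β μ K (ω i, k i))‖ * ‖klSelfEnergy L M β U μ K klE0 (n - 1) (ω i, k i) (σ i)‖ = 0 := by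
    intro i hi
    rw [sliceLineVal_eq_zero_of_weight_eq β μ K n (hω i) (k i) (not_not.mp hi), norm_zero, zero_mul]
  exact klld_sum_le_mul_of_card_le hz0 h0 hb (klld_card_dressed_le_countT L M β μ K hn k)

/-! ## §2 The one-line term of the plain step, bounded -/

/-- **`norm_vertexFn_oneLine_plain_le`** — at step `n ≥ 1`, under (E0)/`RenormalisedAtF R (n−1)`/`TwoLegSlopes R (n−1)`, for legs
`Z_i = ψ̂^{c_i}_{(ω_i,k_i)σ_i}` with `ω_i ∈ {ω₀, −ω₀}`:
`‖𝒱₄(dblFold(Δ_×(g_n)(𝒱_{n−1}⁰𝒱_{n−1}¹)))(Z)‖ ≤ 2·‖𝒱₄(𝒱_{n−1})(Z)‖·(64cr|U|4⁻ⁿ + 16cz|U| + 4cz|U|(π/β)/Λ_n)·legSliceCountT … n k`. -/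
theorem norm_vertexFn_oneLine_plain_le {β U μ : ℝ} (hβ : 0 < β) {K : TrigPolyC4v} {R : RenConsts} (hcr : 0 ≤ R.cr) (hcz : 0 ≤ R.cz)
    {n : ℕ} (hn : 1 ≤ n) (hE0 : SelfEnergySymmetric L M β U μ K (n - 1)) (hren : RenormalisedAtF L M β U μ K R (n - 1))
    (hsl : TwoLegSlopes L M R β U μ K (n - 1)) {ω : Fin 4 → MatsubaraIdx M} (hω : ∀ i, ω i = omega0 M ∨ ω i = (omega0 M).rev)
    (k : Fin 4 → TorusSite 2 L) (σ c : Fin 4 → Fin 2) :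
    ‖vertexFn L M β (dblFold ℂ (grassmannLaplacian ℂ (crossCov ℂ (klSliceCov L M β μ K n))
        (dblCopy ℂ 0 (klEffectiveAction L M β U μ K klE0 (n - 1)) * dblCopy ℂ 1 (klEffectiveAction L M β U μ K klE0 (n - 1))))) 4
        (fun i => (((ω i, k i), σ i), c i))‖ ≤
      2 * ‖vertexFn L M β (klEffectiveAction L M β U μ K klE0 (n - 1)) 4 (fun i => (((ω i, k i), σ i), c i))‖ *
          (64 * R.cr * |U| * ((4 : ℝ) ^ n)⁻¹ + 16 * R.cz * |U| + 4 * R.cz * |U| * ((Real.pi / β) / klScale klE0 n)) *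
        (legSliceCountT L β μ K n k : ℝ) := by
  have hL : (0 : ℝ) < (L : ℝ) := Nat.cast_pos.2 (Nat.pos_of_ne_zero (NeZero.ne L))
  have hβL : 0 < β * (L : ℝ) ^ 2 := by positivity
  set B := 64 * R.cr * |U| * ((4 : ℝ) ^ n)⁻¹ + 16 * R.cz * |U| + 4 * R.cz * |U| * ((Real.pi / β) / klScale klE0 n) with hB
  have h1 := norm_vertexFn_dblFold_oneLine_effectiveAction_le β U μ K klE0 hβ (contr_klSliceCov_eq_diagContr hβ.ne' μ K n) (n - 1)
    (fun i => (((ω i, k i), σ i), c i))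
  have hS := klld_sum_lineVal_mul_selfEnergy_le (L := L) (M := M) hβ hcr hcz hn hE0 hren hsl hω k σ
  refine h1.trans ?_
  dsimp only at hS ⊢
  calc 2 * (β * (L : ℝ) ^ 2)⁻¹ * ‖vertexFn L M β (klEffectiveAction L M β U μ K klE0 (n - 1)) 4 (fun i => (((ω i, k i), σ i), c i))‖ *
        ∑ i : Fin 4, ‖((hubbardCutoffWeightCT L M β μ K (klScale klE0 n) (ω i, k i) -
            hubbardCutoffWeightCT L M β μ K (klScale klE0 (n - 1)) (ω i, k i) : ℝ) : ℂ) *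
          (((β * (L : ℝ) ^ 2 : ℝ) : ℂ) * propCT L M β μ K (ω i, k i))‖ * ‖klSelfEnergy L M β U μ K klE0 (n - 1) (ω i, k i) (σ i)‖
      ≤ 2 * (β * (L : ℝ) ^ 2)⁻¹ * ‖vertexFn L M β (klEffectiveAction L M β U μ K klE0 (n - 1)) 4 (fun i => (((ω i, k i), σ i), c i))‖ *
        (β * (L : ℝ) ^ 2 * B * (legSliceCountT L β μ K n k : ℝ)) := mul_le_mul_of_nonneg_left hS (by positivity)
    _ = _ := by field_simp

/-- **`norm_vertexFn_oneLine_plain_le_legDressBarQ2`** — … and within the (E2-v10) budget term: if moreover `1 ≤ n ≤ n_β + 1`, `klBetaMin ≤ β`,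
`‖𝒱₄(𝒱_{n−1})(Z)‖ ≤ v ≤ Klam·|U|` and `128·cr + 64·cz ≤ Q.CR·Klam` (`Q.CR, Klam ≥ 0`), then
`‖𝒱₄(dblFold(Δ_×(g_n)(𝒱_{n−1}⁰𝒱_{n−1}¹)))(Z)‖ ≤ legDressBarQ2 G P Q U n (legSliceCountT … n k)`. -/
theorem norm_vertexFn_oneLine_plain_le_legDressBarQ2 {β U μ : ℝ} (hβ : klBetaMin ≤ β) {K : TrigPolyC4v} {R : RenConsts} (hcr : 0 ≤ R.cr)
    (hcz : 0 ≤ R.cz) {n : ℕ} (hn1 : 1 ≤ n) (hn : n ≤ nScales β + 1) (hE0 : SelfEnergySymmetric L M β U μ K (n - 1))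
    (hren : RenormalisedAtF L M β U μ K R (n - 1)) (hsl : TwoLegSlopes L M R β U μ K (n - 1))
    (G : GeoConsts) {P : SplitConsts} {Q : EngConsts} (hK : 0 ≤ P.Klam) (hQ0 : 0 ≤ Q.CR) (hCR : 128 * R.cr + 64 * R.cz ≤ Q.CR * P.Klam)
    {ω : Fin 4 → MatsubaraIdx M} (hω : ∀ i, ω i = omega0 M ∨ ω i = (omega0 M).rev) (k : Fin 4 → TorusSite 2 L) (σ c : Fin 4 → Fin 2)
    {v : ℝ} (hv : ‖vertexFn L M β (klEffectiveAction L M β U μ K klE0 (n - 1)) 4 (fun i => (((ω i, k i), σ i), c i))‖ ≤ v)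
    (hvK : v ≤ P.Klam * |U|) :
    ‖vertexFn L M β (dblFold ℂ (grassmannLaplacian ℂ (crossCov ℂ (klSliceCov L M β μ K n))
        (dblCopy ℂ 0 (klEffectiveAction L M β U μ K klE0 (n - 1)) * dblCopy ℂ 1 (klEffectiveAction L M β U μ K klE0 (n - 1))))) 4
        (fun i => (((ω i, k i), σ i), c i))‖ ≤
      legDressBarQ2 G P Q U n (legSliceCountT L β μ K n k) := by
  have hβ0 : 0 < β := pos_of_klBetaMin_le hβ
  have h1 := norm_vertexFn_oneLine_plain_le (L := L) (M := M) hβ0 hcr hcz hn1 hE0 hren hsl hω k σ c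
  have hbr := klld_bracket_le (U := U) hβ hcr hcz hn
  have hcnt : (0 : ℝ) ≤ (legSliceCountT L β μ K n k : ℝ) := Nat.cast_nonneg _
  have hv0 : 0 ≤ v := (norm_nonneg _).trans hv
  have hfin := legDress_size_le_legDressBarQ2 G hK hQ0 hcr hcz hCR U n hvK (legSliceCountT L β μ K n k)
  have hΛ := klth_klScale_pos n
  have hπβ : 0 ≤ Real.pi / β := (div_pos Real.pi_pos hβ0).le
  have hB0 : 0 ≤ 64 * R.cr * |U| * ((4 : ℝ) ^ n)⁻¹ + 16 * R.cz * |U| + 4 * R.cz * |U| * ((Real.pi / β) / klScale klE0 n) := by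
    positivity
  refine h1.trans ?_
  calc 2 * ‖vertexFn L M β (klEffectiveAction L M β U μ K klE0 (n - 1)) 4 (fun i => (((ω i, k i), σ i), c i))‖ *
          (64 * R.cr * |U| * ((4 : ℝ) ^ n)⁻¹ + 16 * R.cz * |U| + 4 * R.cz * |U| * ((Real.pi / β) / klScale klE0 n)) *
        (legSliceCountT L β μ K n k : ℝ)
      ≤ 2 * v * ((64 * R.cr + 32 * R.cz) * |U|) * (legSliceCountT L β μ K n k : ℝ) := by
        refine mul_le_mul_of_nonneg_right ?_ hcnt
        exact mul_le_mul (mul_le_mul_of_nonneg_left hv (by norm_num)) hbr hB0 (by positivity)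
    _ ≤ legDressBarQ2 G P Q U n (legSliceCountT L β μ K n k) := hfin

/-- **`norm_vertexFn_oneLine_plain_le_legDressBarQ2_of_histP_V16`** — the same under EXACTLY the binders of the gen-6 `stub_engine_step_values`
(`P.WF`, `R.WF2`, `klBetaMin ≤ β`, `1 ≤ n ≤ n_β + 1`, `HistP klPredsV16 … n`, `Q := klEngQ5 P R`): no slot or threshold hypothesis left —
only the value bound `‖𝒱₄(𝒱_{n−1})(Z)‖ ≤ v ≤ Klam·|U|` the (E2) prover holds from its own induction. -/
theorem norm_vertexFn_oneLine_plain_le_legDressBarQ2_of_histP_V16 {G : GeoConsts} {P : SplitConsts} {R : RenConsts} {β U μ : ℝ}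
    {K : TrigPolyC4v} {n : ℕ} (hP : P.WF) (hR : R.WF2) (hβ : klBetaMin ≤ β) (hn1 : 1 ≤ n) (hn : n ≤ nScales β + 1)
    (h : HistP klPredsV16 L M G P (klEngQ5 P R) R β U μ K n)
    {ω : Fin 4 → MatsubaraIdx M} (hω : ∀ i, ω i = omega0 M ∨ ω i = (omega0 M).rev) (k : Fin 4 → TorusSite 2 L) (σ c : Fin 4 → Fin 2)
    {v : ℝ} (hv : ‖vertexFn L M β (klEffectiveAction L M β U μ K klE0 (n - 1)) 4 (fun i => (((ω i, k i), σ i), c i))‖ ≤ v)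
    (hvK : v ≤ P.Klam * |U|) :
    ‖vertexFn L M β (dblFold ℂ (grassmannLaplacian ℂ (crossCov ℂ (klSliceCov L M β μ K n))
        (dblCopy ℂ 0 (klEffectiveAction L M β U μ K klE0 (n - 1)) * dblCopy ℂ 1 (klEffectiveAction L M β U μ K klE0 (n - 1))))) 4
        (fun i => (((ω i, k i), σ i), c i))‖ ≤
      legDressBarQ2 G P (klEngQ5 P R) U n (legSliceCountT L β μ K n k) := by
  obtain ⟨hren, hsl⟩ := klld_slots_of_histP_V16 h hn1
  have hE0 : SelfEnergySymmetric L M β U μ K (n - 1) := selfEnergySymmetric_all (L := L) (M := M) β U μ K (n - 1)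
  have hK : 0 ≤ P.Klam := zero_le_one.trans hP.1
  have hQ0 : 0 ≤ (klEngQ5 P R).CR := (klEngQ5_wf P R).2.1
  exact norm_vertexFn_oneLine_plain_le_legDressBarQ2 hβ hR.2.1.le hR.2.2.le hn1 hn hE0 hren hsl G hK hQ0 (legDress_threshold_klEngQ5 hP R)
    hω k σ c hv hvK

end Model

end Summit.HubbardSuperconductivity.HubbardSuperconductivity.Theorems.KLRegimeSplit

end
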